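import Mathlib
import Literature.Computability.AlgebraicComplexity.GroupTheoreticMatMul

/-!
# The CKSU punctured pair for ARBITRARY factor groups: `K₁ × K₂ × K₃` hosts an STPP pair of shapes
`(|K₁|−1, |K₂|−1, |K₃|−1)` and `(|K₂|−1, |K₃|−1, |K₁|−1)` (cell mm-stpp, eng-1 g6)

The tree's `isSTPP_puncturedAxes_pair` (Literature/…/STPPPuncturedAxesPair.lean) is the CKSU 2005 §5 example in
`(ℤ/n)³`.  Its proof only uses "this coordinate is zero / non-zero", so it holds verbatim for any three additive
groups `K₁, K₂, K₃`: with `P₀ = {(x,0,0) : x ≠ 0}`, `P₁ = {(0,y,0) : y ≠ 0}`, `P₂ = {(0,0,z) : z ≠ 0}` in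
`K₁ × K₂ × K₃`, the family `![P₀, P₁] ![P₁, P₂] ![P₂, P₀]` is `IsSTPP`.  This is the existence half of the
cell's observation that at order `(s+1)³` the hosts of an STPP `(s,s,s)²` pair found by search are exactly the
abelian groups containing `K₁ ⊕ K₂ ⊕ K₃` with `|Kᵢ| = s+1` of ANY isomorphism type (e.g. `(3,3,3)²` in
`(ℤ/2)⁶`, `(7,7,7)²` in `(ℤ/2)⁹` or `(ℤ/4 × ℤ/2)³`), and of the mixed designs `(a,b,c) + (b,c,a)` at order
`(a+1)(b+1)(c+1)` (e.g. `(3,5,5)+(5,5,3)` at `144`, `(3,6,5)+(6,5,3)` at `168`).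

WHAT THIS IS NOT: no statement about ω; an existence fact (upper end), not an exclusion.
-/

-- single-conjunct summit: the mandated namespace repeats `MatrixMultiplication`.
set_option linter.dupNamespace false

namespace Summit.MatrixMultiplication.MatrixMultiplication.Theorems.STPPPuncturedSubgroups

open Finset
open Literature.Computability.AlgebraicComplexity (IsSTPP)

variable {K₁ K₂ K₃ : Type*} [AddCommGroup K₁] [AddCommGroup K₂] [AddCommGroup K₃]
  {P₀ P₁ P₂ : Finset (K₁ × K₂ × K₃)}

/-- Membership form (same text as the tree's `(ℤ/n)³` lemma `isSTPP_puncturedAxes_pair`, but over arbitrary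
`K₁ × K₂ × K₃`; kept private — the public statement is the existential/filter form below).
[cite: CohnKleinbergSzegedyUmans2005, Prop. 5.2] -/
private theorem isSTPP_puncturedSubgroups_pair_mem
    (hP₀ : ∀ v, v ∈ P₀ ↔ v.1 ≠ 0 ∧ v.2.1 = 0 ∧ v.2.2 = 0)
    (hP₁ : ∀ v, v ∈ P₁ ↔ v.2.1 ≠ 0 ∧ v.1 = 0 ∧ v.2.2 = 0)
    (hP₂ : ∀ v, v ∈ P₂ ↔ v.2.2 ≠ 0 ∧ v.1 = 0 ∧ v.2.1 = 0) :
    IsSTPP ![P₀, P₁] ![P₁, P₂] ![P₂, P₀] := by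
  intro i j k s hs s' hs' t ht t' ht' u hu u' hu' h0
  have h1 := congrArg Prod.fst h0
  have h2 := congrArg (fun v => v.2.1) h0
  have h3 := congrArg (fun v => v.2.2) h0
  simp only [Prod.fst_add, Prod.fst_sub, Prod.snd_add, Prod.snd_sub, Prod.fst_zero, Prod.snd_zero]
    at h1 h2 h3
  fin_cases i <;> fin_cases j <;> fin_cases k <;>
    simp only [Fin.zero_eta, Fin.mk_one, Fin.isValue, Matrix.cons_val_zero, Matrix.cons_val_one,
      hP₀, hP₁, hP₂] at hs hs' ht ht' hu hu'
  · -- (0,0,0)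
    obtain ⟨-, hs2, hs3⟩ := hs; obtain ⟨-, hs'2, hs'3⟩ := hs'
    obtain ⟨-, ht1, ht3⟩ := ht; obtain ⟨-, ht'1, ht'3⟩ := ht'
    obtain ⟨-, hu1, hu2⟩ := hu; obtain ⟨-, hu'1, hu'2⟩ := hu'
    rw [ht1, ht'1, hu1, hu'1] at h1
    rw [hs2, hs'2, hu2, hu'2] at h2
    rw [hs3, hs'3, ht3, ht'3] at h3
    simp only [sub_self, add_zero, zero_add, sub_eq_zero] at h1 h2 h3
    refine ⟨rfl, rfl, Prod.ext ?_ (Prod.ext ?_ ?_), Prod.ext ?_ (Prod.ext ?_ ?_),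
      Prod.ext ?_ (Prod.ext ?_ ?_)⟩
    · exact h1.symm
    · rw [hs2, hs'2]
    · rw [hs3, hs'3]
    · rw [ht1, ht'1]
    · exact h2.symm
    · rw [ht3, ht'3]
    · rw [hu1, hu'1]
    · rw [hu2, hu'2]
    · exact h3.symm
  · -- (0,0,1): coordinate 2 sees only `u`
    exfalso; apply hu.1
    rw [hs'.2.2, hs.2.2, ht'.2.2, ht.2.2, hu'.2.2] at h3
    simpa using h3
  · -- (0,1,0): coordinate 1 sees only `t`
    exfalso; apply ht.1
    rw [hs'.2.1, hs.2.1, ht'.2.2, hu'.2.2, hu.2.1] at h2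
    simpa using h2
  · -- (0,1,1): coordinate 2 sees only `t'`
    exfalso; apply ht'.1
    rw [hs'.2.2, hs.2.2, ht.2.2, hu'.2.2, hu.2.2] at h3
    simpa using h3
  · -- (1,0,0): coordinate 0 sees only `s`
    exfalso; apply hs.1
    rw [hs'.2.1, ht'.2.1, ht.2.1, hu'.2.1, hu.2.1] at h1
    simpa using h1
  · -- (1,0,1): coordinate 0 sees only `u'`
    exfalso; apply hu'.1
    rw [hs'.2.1, hs.2.1, ht'.2.1, ht.2.1, hu.2.1] at h1
    simpa using h1
  · -- (1,1,0): coordinate 1 sees only `s'`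
    exfalso; apply hs'.1
    rw [hs.2.1, ht'.2.2, ht.2.2, hu'.2.2, hu.2.1] at h2
    simpa using h2
  · -- (1,1,1)
    obtain ⟨-, hs1, hs3⟩ := hs; obtain ⟨-, hs'1, hs'3⟩ := hs'
    obtain ⟨-, ht1, ht2⟩ := ht; obtain ⟨-, ht'1, ht'2⟩ := ht'
    obtain ⟨-, hu2, hu3⟩ := hu; obtain ⟨-, hu'2, hu'3⟩ := hu'
    rw [hs1, hs'1, ht1, ht'1] at h1
    rw [ht2, ht'2, hu2, hu'2] at h2
    rw [hs3, hs'3, hu3, hu'3] at h3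
    simp only [sub_self, add_zero, zero_add, sub_eq_zero] at h1 h2 h3
    refine ⟨rfl, rfl, Prod.ext ?_ (Prod.ext ?_ ?_), Prod.ext ?_ (Prod.ext ?_ ?_),
      Prod.ext ?_ (Prod.ext ?_ ?_)⟩
    · rw [hs1, hs'1]
    · exact h2.symm
    · rw [hs3, hs'3]
    · rw [ht1, ht'1]
    · rw [ht2, ht'2]
    · exact h3.symm
    · exact h1.symm
    · rw [hu2, hu'2]
    · rw [hu3, hu'3]

/-- The concrete punctured subgroups as `Finset.filter`s (for finite factors), and the existential corollary:
every `K₁ × K₂ × K₃` with finite factors hosts an STPP pair of shapes `(|K₁|−1, |K₂|−1, |K₃|−1)`,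
`(|K₂|−1, |K₃|−1, |K₁|−1)`. [cite: CohnKleinbergSzegedyUmans2005, Prop. 5.2] -/
theorem exists_isSTPP_puncturedSubgroups_pair [Fintype K₁] [Fintype K₂] [Fintype K₃]
    [DecidableEq K₁] [DecidableEq K₂] [DecidableEq K₃] :
    ∃ A B C : Fin 2 → Finset (K₁ × K₂ × K₃), IsSTPP A B C ∧
      (A 0).card = Fintype.card K₁ - 1 ∧ (B 0).card = Fintype.card K₂ - 1 ∧ (C 0).card = Fintype.card K₃ - 1 ∧
      (A 1).card = Fintype.card K₂ - 1 ∧ (B 1).card = Fintype.card K₃ - 1 ∧ (C 1).card = Fintype.card K₁ - 1 := by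
  classical
  let P₀ : Finset (K₁ × K₂ × K₃) := univ.filter fun v => v.1 ≠ 0 ∧ v.2.1 = 0 ∧ v.2.2 = 0
  let P₁ : Finset (K₁ × K₂ × K₃) := univ.filter fun v => v.2.1 ≠ 0 ∧ v.1 = 0 ∧ v.2.2 = 0
  let P₂ : Finset (K₁ × K₂ × K₃) := univ.filter fun v => v.2.2 ≠ 0 ∧ v.1 = 0 ∧ v.2.1 = 0
  have hP₀ : ∀ v, v ∈ P₀ ↔ v.1 ≠ 0 ∧ v.2.1 = 0 ∧ v.2.2 = 0 := fun v => by simp [P₀]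
  have hP₁ : ∀ v, v ∈ P₁ ↔ v.2.1 ≠ 0 ∧ v.1 = 0 ∧ v.2.2 = 0 := fun v => by simp [P₁]
  have hP₂ : ∀ v, v ∈ P₂ ↔ v.2.2 ≠ 0 ∧ v.1 = 0 ∧ v.2.1 = 0 := fun v => by simp [P₂]
  -- cardinalities: each Pᵢ is the image of `Kᵢ ∖ {0}` under the injective axis embedding
  have c0 : P₀.card = Fintype.card K₁ - 1 := by
    have : P₀ = (univ.erase (0 : K₁)).image fun x => (x, (0 : K₂), (0 : K₃)) := by
      ext v; simp only [hP₀, mem_image, mem_erase, mem_univ, ne_eq, and_true]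
      constructor
      · rintro ⟨h1, h2, h3⟩; exact ⟨v.1, h1, Prod.ext rfl (Prod.ext h2.symm h3.symm)⟩
      · rintro ⟨x, hx, rfl⟩; exact ⟨hx, rfl, rfl⟩
    rw [this, card_image_of_injective _ (fun x y hxy => by simpa using congrArg Prod.fst hxy),
      card_erase_of_mem (mem_univ _), card_univ]
  have c1 : P₁.card = Fintype.card K₂ - 1 := by
    have : P₁ = (univ.erase (0 : K₂)).image fun y => ((0 : K₁), y, (0 : K₃)) := by
      ext v; simp only [hP₁, mem_image, mem_erase, mem_univ, ne_eq, and_true]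
      constructor
      · rintro ⟨h1, h2, h3⟩; exact ⟨v.2.1, h1, Prod.ext h2.symm (Prod.ext rfl h3.symm)⟩
      · rintro ⟨x, hx, rfl⟩; exact ⟨hx, rfl, rfl⟩
    rw [this, card_image_of_injective _ (fun x y hxy => by simpa using congrArg (fun v => v.2.1) hxy),
      card_erase_of_mem (mem_univ _), card_univ]
  have c2 : P₂.card = Fintype.card K₃ - 1 := by
    have : P₂ = (univ.erase (0 : K₃)).image fun z => ((0 : K₁), (0 : K₂), z) := by
      ext v; simp only [hP₂, mem_image, mem_erase, mem_univ, ne_eq, and_true]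
      constructor
      · rintro ⟨h1, h2, h3⟩; exact ⟨v.2.2, h1, Prod.ext h2.symm (Prod.ext h3.symm rfl)⟩
      · rintro ⟨x, hx, rfl⟩; exact ⟨hx, rfl, rfl⟩
    rw [this, card_image_of_injective _ (fun x y hxy => by simpa using congrArg (fun v => v.2.2) hxy),
      card_erase_of_mem (mem_univ _), card_univ]
  exact ⟨![P₀, P₁], ![P₁, P₂], ![P₂, P₀], isSTPP_puncturedSubgroups_pair_mem hP₀ hP₁ hP₂,
    by simpa using c0, by simpa using c1, by simpa using c2, by simpa using c1, by simpa using c2,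
    by simpa using c0⟩

end Summit.MatrixMultiplication.MatrixMultiplication.Theorems.STPPPuncturedSubgroups
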